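import Summits.AtomisticToContinuum.FouriersLaw.Theorems.BondHeatUncertaintyBoundedResponseParityFloorProofA
import HarnessLib

/-!
# NODE 95 «ParityFloorProof» (lens-1 g95): (L) proved beneath ParityFloor — part 2 of 3 (sequel of `…BondHeatUncertaintyBoundedResponseParityFloorProofA`)

Split for the 400-line cap by the landing lane (hand-2 g35); the module docstring of part 1 (`…BondHeatUncertaintyBoundedResponseParityFloorProofA`) describes the whole node.  Same namespace; all FQNs unchanged.
0 sorry; standard axioms.
-/

noncomputable section
open MeasureTheory ProbabilityTheory Filter Topology Set Function
open scoped NNReal ENNReal ContDiff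
open Literature.MathematicalPhysics.KineticTheory.HeatConduction
open Literature.MathematicalPhysics.KineticTheory OscillatorChain
open Summit.AtomisticToContinuum.FouriersLaw.Theorems.SubdiffusiveBondHeat
open Summit.AtomisticToContinuum.FouriersLaw.Theorems.OddSectorIrreversibility
open Summit.AtomisticToContinuum.FouriersLaw.Theorems.ExtensiveSnapshotIrreversibility.ClausiusBudget
open Summit.AtomisticToContinuum.FouriersLaw.Theorems.HonestZwanzig
open Summit.AtomisticToContinuum.FouriersLaw.Theorems.BoundedResponse.TransientBand
open Summit.AtomisticToContinuum.FouriersLaw.Cruxes.SuperadditiveResistance.FloatingProbeBypassLaplacian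

namespace Summit.AtomisticToContinuum.FouriersLaw.Theorems.BoundedResponse.ParityFloor

open Summit.AtomisticToContinuum.FouriersLaw.Theses.BondHeatUncertainty (BoundedResponse ExtensiveSnapshotIrreversibility)
open Summit.AtomisticToContinuum.FouriersLaw.Theorems.SubdiffusiveBondHeat.EscapeGrading (OhmicFloor ExponentFloor)
open Summit.AtomisticToContinuum.FouriersLaw.Theorems.BoundedResponse.TransientBand
  (DeficitCesaroPoint TransientFloor DeficitCesaroGrade)

variable {N : ℕ}

section Pinned

variable {ω₂ lam β γ T : ℝ}

/-! ## §4 Dynamics: the time-reversed kernel, the tail of `K_N`, and the `L²`-contraction floor -/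

/-- **Time-reversed escape kernel**: for `u, s ≥ 0`, `K_N(u+s) = ∫ v_s(Θz)·v_u(z) dμ_T` — Chapman–Kolmogorov
`v_{u+s} = P_u v_s`, detailed balance `∫ θ₀·P_u v_s dμ_T = ∫ (v_s∘Θ)·P_u(θ₀∘Θ) dμ_T`, and `θ₀∘Θ = θ₀`.
[cite: ReyBellet2006, Lemma 4.2] -/
theorem escapeKernel_add_eq (hω : 0 < ω₂) (hl : 0 < lam) (hβ : 0 < β) (hγ : 0 < γ) (hN : 0 < N) (hT : 0 < T)
    {u s : ℝ} (hu : 0 ≤ u) (hs : 0 ≤ s) :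
    escapeKernel ω₂ lam β γ T N (u + s) =
      ∫ z, kinAct ω₂ lam β γ T N ⟨0, hN⟩ s (z.1, -z.2) * kinAct ω₂ lam β γ T N ⟨0, hN⟩ u z
        ∂((pinnedChain ω₂ lam β γ).gibbsMeasure N T) := by
  have hϑ0 : (0 : ℝ) < 1 / (4 * T) := by positivity
  have h2ϑ : 2 * (1 / (4 * T)) < 1 / T := by
    rw [show 2 * (1 / (4 * T)) = 1 / (2 * T) by ring, one_div_lt_one_div (by positivity) hT]; linarith
  rw [escapeKernel_of_pos hN]
  have hCK : ∀ z : PhaseSpace N,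
      ∫ y, ((y.2 ⟨0, hN⟩) ^ 2 - T) ∂((pinnedChain ω₂ lam β γ).transitionKernel N T T (u + s).toNNReal z) =
        ∫ y, kinAct ω₂ lam β γ T N ⟨0, hN⟩ s y ∂((pinnedChain ω₂ lam β γ).transitionKernel N T T u.toNNReal z) :=
      fun z => by
    rw [act_kinAct_eq hω hl.le hβ.le hγ.le hN hT ⟨0, hN⟩ hs hu z, add_comm s u]; rfl
  simp_rw [hCK]
  have hθ2 := OddSectorIrreversibility.pinnedChain_integral_sq_act_le_of_stronglyMeasurable hω hl.le hβ hγ hN hT hϑ0 h2ϑ (continuous_kinObs T ⟨0, hN⟩).stronglyMeasurable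
    (fun y => abs_kinObs_le (γ := γ) hω hl.le hβ.le hT.le hϑ0 ⟨0, hN⟩ y) s.toNNReal
  have hDB := SubdiffusiveBondHeat.pinnedChain_detailedBalance hω hl hβ hγ hN hT (continuous_kinObs T ⟨0, hN⟩).measurable
    (stronglyMeasurable_kinAct ω₂ lam β γ T ⟨0, hN⟩ s).measurable hθ2.1 hθ2.2.1 u.toNNReal
  refine hDB.trans (integral_congr_ae (Eventually.of_forall fun z => ?_))
  dsimp only
  congr 1
  exact integral_congr_ae (Eventually.of_forall fun y => kinObs_reversal T ⟨0, hN⟩ y)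

/-- **The tail of `K_N` is a corrector pairing**: for `s ≥ 0`, `∫_{(0,∞)} K_N(u+s) du = ∫ v_s(Θz)·h₀(z) dμ_T`
(Fubini with the decaying dominant on `μ_T ⊗ du`). [folklore] -/
theorem setIntegral_escapeKernel_add_eq (hω : 0 < ω₂) (hl : 0 < lam) (hβ : 0 < β) (hγ : 0 < γ) (hN : 0 < N)
    (hT : 0 < T) {ϑ K c : ℝ} (hϑ0 : 0 < ϑ) (h2ϑ : 2 * ϑ < 1 / T) (hK : 0 ≤ K)
    (hb : ∀ (z : PhaseSpace N) (t : ℝ≥0) (f : PhaseSpace N → ℝ), Continuous f → ∀ C : ℝ, 0 ≤ C →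
      (∀ y, |f y| ≤ C * Real.exp (ϑ * (pinnedChain ω₂ lam β γ).hamiltonian N y)) →
      |(∫ y, f y ∂((pinnedChain ω₂ lam β γ).transitionKernel N T T t z)) -
          ∫ y, f y ∂((pinnedChain ω₂ lam β γ).gibbsMeasure N T)| ≤
        K * C * Real.exp (ϑ * (pinnedChain ω₂ lam β γ).hamiltonian N z) * Real.exp (-c * t))
    (hc : 0 < c) {s : ℝ} (hs : 0 ≤ s) :
    ∫ u in Ioi 0, escapeKernel ω₂ lam β γ T N (u + s) =
      ∫ z, kinAct ω₂ lam β γ T N ⟨0, hN⟩ s (z.1, -z.2) * kinCorrector ω₂ lam β γ T N ⟨0, hN⟩ z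
        ∂((pinnedChain ω₂ lam β γ).gibbsMeasure N T) := by
  set P := pinnedChain ω₂ lam β γ with hP
  haveI : IsProbabilityMeasure (P.gibbsMeasure N T) :=
    pinnedChain_isProbabilityMeasure_gibbsMeasure hω hl.le hβ.le γ N hT
  have h1 : ∀ u ∈ Ioi (0 : ℝ), escapeKernel ω₂ lam β γ T N (u + s) =
      ∫ z, kinAct ω₂ lam β γ T N ⟨0, hN⟩ s (z.1, -z.2) * kinAct ω₂ lam β γ T N ⟨0, hN⟩ u z ∂(P.gibbsMeasure N T) :=
    fun u hu => escapeKernel_add_eq hω hl hβ hγ hN hT (le_of_lt hu) hs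
  rw [setIntegral_congr_fun measurableSet_Ioi h1]
  have hν : Integrable (fun y => Real.exp (2 * ϑ * P.hamiltonian N y)) (P.gibbsMeasure N T) :=
    pinnedChain_integrable_exp_mul_hamiltonian_gibbsMeasure hω hl.le hβ.le γ N hT h2ϑ
  have hFm : StronglyMeasurable fun z : PhaseSpace N => kinAct ω₂ lam β γ T N ⟨0, hN⟩ s (z.1, -z.2) :=
    (stronglyMeasurable_kinAct ω₂ lam β γ T ⟨0, hN⟩ s).comp_measurable (measurable_fst.prodMk measurable_snd.neg)
  have hv2 : Integrable (fun y => kinAct ω₂ lam β γ T N ⟨0, hN⟩ s y ^ 2) (P.gibbsMeasure N T) :=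
    (OddSectorIrreversibility.pinnedChain_integral_sq_act_le_of_stronglyMeasurable hω hl.le hβ hγ hN hT hϑ0 h2ϑ (continuous_kinObs T ⟨0, hN⟩).stronglyMeasurable
      (fun y => abs_kinObs_le (γ := γ) hω hl.le hβ.le hT.le hϑ0 ⟨0, hN⟩ y) s.toNNReal).2.1
  have hF2 : Integrable (fun z : PhaseSpace N => kinAct ω₂ lam β γ T N ⟨0, hN⟩ s (z.1, -z.2) ^ 2)
      (P.gibbsMeasure N T) :=
    integrable_flip_gibbsMeasure P N T (F := fun y => kinAct ω₂ lam β γ T N ⟨0, hN⟩ s y ^ 2) hv2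
  unfold kinCorrector
  exact (integral_mul_setIntegral_kinAct hω hl.le hβ.le hγ.le hT hϑ0 hK hb hc ⟨0, hN⟩ (P.gibbsMeasure N T) hν hFm
    hF2 Subset.rfl).symm

/-- **Integrated tail = corrector-increment pairing**: for `t ≥ 0`,
`∫₀ᵗ (∫_{(0,∞)} K_N(u+s) du) ds = ∫ h₀(Θz)·(h₀(z) − P_t h₀(z)) dμ_T` (`Θ`-invariance of `μ_T`, Fubini on `μ_T ⊗ ds|_{(0,t]}`,
the shift identity). [folklore] -/
theorem integral_tail_eq (hω : 0 < ω₂) (hl : 0 < lam) (hβ : 0 < β) (hγ : 0 < γ) (hN : 0 < N)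
    (hT : 0 < T) {ϑ K c : ℝ} (hϑ0 : 0 < ϑ) (h2ϑ : 2 * ϑ < 1 / T) (hK : 0 ≤ K)
    (hb : ∀ (z : PhaseSpace N) (t : ℝ≥0) (f : PhaseSpace N → ℝ), Continuous f → ∀ C : ℝ, 0 ≤ C →
      (∀ y, |f y| ≤ C * Real.exp (ϑ * (pinnedChain ω₂ lam β γ).hamiltonian N y)) →
      |(∫ y, f y ∂((pinnedChain ω₂ lam β γ).transitionKernel N T T t z)) -
          ∫ y, f y ∂((pinnedChain ω₂ lam β γ).gibbsMeasure N T)| ≤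
        K * C * Real.exp (ϑ * (pinnedChain ω₂ lam β γ).hamiltonian N z) * Real.exp (-c * t))
    (hc : 0 < c) {t : ℝ} (ht : 0 ≤ t) :
    ∫ s in (0 : ℝ)..t, (∫ u in Ioi 0, escapeKernel ω₂ lam β γ T N (u + s)) =
      ∫ z, kinCorrector ω₂ lam β γ T N ⟨0, hN⟩ (z.1, -z.2) * (kinCorrector ω₂ lam β γ T N ⟨0, hN⟩ z -
        ∫ y, kinCorrector ω₂ lam β γ T N ⟨0, hN⟩ y ∂((pinnedChain ω₂ lam β γ).transitionKernel N T T t.toNNReal z))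
        ∂((pinnedChain ω₂ lam β γ).gibbsMeasure N T) := by
  set P := pinnedChain ω₂ lam β γ with hP
  haveI : IsProbabilityMeasure (P.gibbsMeasure N T) :=
    pinnedChain_isProbabilityMeasure_gibbsMeasure hω hl.le hβ.le γ N hT
  rw [intervalIntegral.integral_of_le ht]
  have h1 : ∀ s ∈ Ioc (0 : ℝ) t, ∫ u in Ioi 0, escapeKernel ω₂ lam β γ T N (u + s) =
      ∫ z, kinCorrector ω₂ lam β γ T N ⟨0, hN⟩ (z.1, -z.2) * kinAct ω₂ lam β γ T N ⟨0, hN⟩ s z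
        ∂(P.gibbsMeasure N T) := fun s hs => by
    rw [setIntegral_escapeKernel_add_eq hω hl hβ hγ hN hT hϑ0 h2ϑ hK hb hc (le_of_lt hs.1),
      ← integral_flip_gibbsMeasure P N T
        (fun z => kinCorrector ω₂ lam β γ T N ⟨0, hN⟩ (z.1, -z.2) * kinAct ω₂ lam β γ T N ⟨0, hN⟩ s z)]
    refine integral_congr_ae (Eventually.of_forall fun z => ?_)
    simp only [neg_neg, Prod.mk.eta]
    ring
  rw [setIntegral_congr_fun measurableSet_Ioc h1]
  have hν : Integrable (fun y => Real.exp (2 * ϑ * P.hamiltonian N y)) (P.gibbsMeasure N T) :=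
    pinnedChain_integrable_exp_mul_hamiltonian_gibbsMeasure hω hl.le hβ.le γ N hT h2ϑ
  have hFm : StronglyMeasurable fun z : PhaseSpace N => kinCorrector ω₂ lam β γ T N ⟨0, hN⟩ (z.1, -z.2) :=
    (stronglyMeasurable_kinCorrector hω hl.le hβ.le hγ.le T ⟨0, hN⟩).comp_measurable
      (measurable_fst.prodMk measurable_snd.neg)
  have hh2 : Integrable (fun y => kinCorrector ω₂ lam β γ T N ⟨0, hN⟩ y ^ 2) (P.gibbsMeasure N T) :=
    (OddSectorIrreversibility.pinnedChain_integral_sq_act_le_of_stronglyMeasurable hω hl.le hβ hγ hN hT hϑ0 h2ϑ (stronglyMeasurable_kinCorrector hω hl.le hβ.le hγ.le T ⟨0, hN⟩)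
      (fun y => abs_kinCorrector_le hω hl.le hβ hγ hT hϑ0 hb hc ⟨0, hN⟩ y) 0).1
  have hF2 : Integrable (fun z : PhaseSpace N => kinCorrector ω₂ lam β γ T N ⟨0, hN⟩ (z.1, -z.2) ^ 2)
      (P.gibbsMeasure N T) :=
    integrable_flip_gibbsMeasure P N T (F := fun y => kinCorrector ω₂ lam β γ T N ⟨0, hN⟩ y ^ 2) hh2
  rw [← integral_mul_setIntegral_kinAct hω hl.le hβ.le hγ.le hT hϑ0 hK hb hc ⟨0, hN⟩ (P.gibbsMeasure N T) hν hFm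
    hF2 (S := Ioc 0 t) (fun s hs => hs.1)]
  refine integral_congr_ae (Eventually.of_forall fun z => ?_)
  dsimp only
  rw [act_kinCorrector_eq hω hl.le hβ hγ hN hT hϑ0 h2ϑ hK hb hc ⟨0, hN⟩ ht z, intervalIntegral.integral_of_le ht]
  ring

/-- **`L²`-contraction floor**: `∫ h₀(Θz)·(h₀(z) − P_t h₀(z)) dμ_T ≥ −½ ∫ (h₀ − h₀∘Θ)² dμ_T` — from
`∫ (h₀∘Θ)² dμ_T = ∫ h₀² dμ_T` (`Θ`-invariance), `∫ (P_t h₀)² dμ_T ≤ ∫ h₀² dμ_T` (contraction) and `2ab ≤ a² + b²`.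
[folklore] -/
theorem integral_reversal_mul_sub_act_ge (hω : 0 < ω₂) (hl : 0 ≤ lam) (hβ : 0 < β) (hγ : 0 < γ) (hN : 0 < N)
    (hT : 0 < T) {ϑ K c : ℝ} (hϑ0 : 0 < ϑ) (h2ϑ : 2 * ϑ < 1 / T)
    (hb : ∀ (z : PhaseSpace N) (t : ℝ≥0) (f : PhaseSpace N → ℝ), Continuous f → ∀ C : ℝ, 0 ≤ C →
      (∀ y, |f y| ≤ C * Real.exp (ϑ * (pinnedChain ω₂ lam β γ).hamiltonian N y)) →
      |(∫ y, f y ∂((pinnedChain ω₂ lam β γ).transitionKernel N T T t z)) -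
          ∫ y, f y ∂((pinnedChain ω₂ lam β γ).gibbsMeasure N T)| ≤
        K * C * Real.exp (ϑ * (pinnedChain ω₂ lam β γ).hamiltonian N z) * Real.exp (-c * t))
    (hc : 0 < c) (t : ℝ≥0) :
    -(1 / 2 : ℝ) * ∫ z, (kinCorrector ω₂ lam β γ T N ⟨0, hN⟩ z - kinCorrector ω₂ lam β γ T N ⟨0, hN⟩ (z.1, -z.2)) ^ 2
        ∂((pinnedChain ω₂ lam β γ).gibbsMeasure N T) ≤
      ∫ z, kinCorrector ω₂ lam β γ T N ⟨0, hN⟩ (z.1, -z.2) * (kinCorrector ω₂ lam β γ T N ⟨0, hN⟩ z -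
        ∫ y, kinCorrector ω₂ lam β γ T N ⟨0, hN⟩ y ∂((pinnedChain ω₂ lam β γ).transitionKernel N T T t z))
        ∂((pinnedChain ω₂ lam β γ).gibbsMeasure N T) := by
  set P := pinnedChain ω₂ lam β γ with hP
  haveI : IsProbabilityMeasure (P.gibbsMeasure N T) :=
    pinnedChain_isProbabilityMeasure_gibbsMeasure hω hl hβ.le γ N hT
  have hbm : StronglyMeasurable (kinCorrector ω₂ lam β γ T N ⟨0, hN⟩) :=
    stronglyMeasurable_kinCorrector hω hl hβ.le hγ.le T ⟨0, hN⟩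
  obtain ⟨hb2, hp2, hcontr⟩ := OddSectorIrreversibility.pinnedChain_integral_sq_act_le_of_stronglyMeasurable hω hl hβ hγ hN hT hϑ0 h2ϑ hbm
    (fun y => abs_kinCorrector_le hω hl hβ hγ hT hϑ0 hb hc ⟨0, hN⟩ y) t
  have ham : StronglyMeasurable fun z : PhaseSpace N => kinCorrector ω₂ lam β γ T N ⟨0, hN⟩ (z.1, -z.2) :=
    hbm.comp_measurable (measurable_fst.prodMk measurable_snd.neg)
  have hpm : StronglyMeasurable fun z : PhaseSpace N =>
      ∫ y, kinCorrector ω₂ lam β γ T N ⟨0, hN⟩ y ∂(P.transitionKernel N T T t z) :=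
    hbm.integral_kernel (κ := P.transitionKernel N T T t)
  have ha2 : Integrable (fun z : PhaseSpace N => kinCorrector ω₂ lam β γ T N ⟨0, hN⟩ (z.1, -z.2) ^ 2)
      (P.gibbsMeasure N T) :=
    integrable_flip_gibbsMeasure P N T (F := fun y => kinCorrector ω₂ lam β γ T N ⟨0, hN⟩ y ^ 2) hb2
  have ia2 : ∫ z, kinCorrector ω₂ lam β γ T N ⟨0, hN⟩ (z.1, -z.2) ^ 2 ∂(P.gibbsMeasure N T) =
      ∫ z, kinCorrector ω₂ lam β γ T N ⟨0, hN⟩ z ^ 2 ∂(P.gibbsMeasure N T) :=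
    integral_flip_gibbsMeasure P N T (fun y => kinCorrector ω₂ lam β γ T N ⟨0, hN⟩ y ^ 2)
  have iab := integrable_mul_of_integrable_sq ham.aestronglyMeasurable hbm.aestronglyMeasurable ha2 hb2
  have iap := integrable_mul_of_integrable_sq ham.aestronglyMeasurable hpm.aestronglyMeasurable ha2 hp2
  -- `∫ a·p ≤ (∫ a² + ∫ p²)/2`
  have h1 : ∫ z, kinCorrector ω₂ lam β γ T N ⟨0, hN⟩ (z.1, -z.2) *
        (∫ y, kinCorrector ω₂ lam β γ T N ⟨0, hN⟩ y ∂(P.transitionKernel N T T t z)) ∂(P.gibbsMeasure N T) ≤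
      ((∫ z, kinCorrector ω₂ lam β γ T N ⟨0, hN⟩ (z.1, -z.2) ^ 2 ∂(P.gibbsMeasure N T)) +
        ∫ z, (∫ y, kinCorrector ω₂ lam β γ T N ⟨0, hN⟩ y ∂(P.transitionKernel N T T t z)) ^ 2
          ∂(P.gibbsMeasure N T)) / 2 := by
    rw [← integral_add ha2 hp2, ← integral_div]
    exact integral_mono iap ((ha2.add hp2).div_const 2) fun z => by
      nlinarith [sq_nonneg (kinCorrector ω₂ lam β γ T N ⟨0, hN⟩ (z.1, -z.2) -
        ∫ y, kinCorrector ω₂ lam β γ T N ⟨0, hN⟩ y ∂(P.transitionKernel N T T t z))]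
  -- `∫ (b − a)² = ∫ b² − 2∫ a·b + ∫ a²`
  have h2 : ∫ z, (kinCorrector ω₂ lam β γ T N ⟨0, hN⟩ z - kinCorrector ω₂ lam β γ T N ⟨0, hN⟩ (z.1, -z.2)) ^ 2
        ∂(P.gibbsMeasure N T) =
      (∫ z, kinCorrector ω₂ lam β γ T N ⟨0, hN⟩ z ^ 2 ∂(P.gibbsMeasure N T)) -
        2 * (∫ z, kinCorrector ω₂ lam β γ T N ⟨0, hN⟩ (z.1, -z.2) * kinCorrector ω₂ lam β γ T N ⟨0, hN⟩ z
          ∂(P.gibbsMeasure N T)) +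
        ∫ z, kinCorrector ω₂ lam β γ T N ⟨0, hN⟩ (z.1, -z.2) ^ 2 ∂(P.gibbsMeasure N T) := by
    have i1 : Integrable (fun z : PhaseSpace N => kinCorrector ω₂ lam β γ T N ⟨0, hN⟩ z ^ 2 -
        2 * (kinCorrector ω₂ lam β γ T N ⟨0, hN⟩ (z.1, -z.2) * kinCorrector ω₂ lam β γ T N ⟨0, hN⟩ z))
        (P.gibbsMeasure N T) := hb2.sub (iab.const_mul 2)
    have e : (fun z : PhaseSpace N => (kinCorrector ω₂ lam β γ T N ⟨0, hN⟩ z -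
        kinCorrector ω₂ lam β γ T N ⟨0, hN⟩ (z.1, -z.2)) ^ 2) = fun z =>
        (kinCorrector ω₂ lam β γ T N ⟨0, hN⟩ z ^ 2 -
          2 * (kinCorrector ω₂ lam β γ T N ⟨0, hN⟩ (z.1, -z.2) * kinCorrector ω₂ lam β γ T N ⟨0, hN⟩ z)) +
        kinCorrector ω₂ lam β γ T N ⟨0, hN⟩ (z.1, -z.2) ^ 2 := funext fun z => by ring
    rw [e, integral_add i1 ha2, integral_sub hb2 (iab.const_mul 2), integral_const_mul]
  -- `∫ a·(b − p) = ∫ a·b − ∫ a·p`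
  have h3 : ∫ z, kinCorrector ω₂ lam β γ T N ⟨0, hN⟩ (z.1, -z.2) * (kinCorrector ω₂ lam β γ T N ⟨0, hN⟩ z -
        ∫ y, kinCorrector ω₂ lam β γ T N ⟨0, hN⟩ y ∂(P.transitionKernel N T T t z)) ∂(P.gibbsMeasure N T) =
      (∫ z, kinCorrector ω₂ lam β γ T N ⟨0, hN⟩ (z.1, -z.2) * kinCorrector ω₂ lam β γ T N ⟨0, hN⟩ z
          ∂(P.gibbsMeasure N T)) -
        ∫ z, kinCorrector ω₂ lam β γ T N ⟨0, hN⟩ (z.1, -z.2) *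
          (∫ y, kinCorrector ω₂ lam β γ T N ⟨0, hN⟩ y ∂(P.transitionKernel N T T t z)) ∂(P.gibbsMeasure N T) := by
    rw [← integral_sub iab iap]
    exact integral_congr_ae (Eventually.of_forall fun z => by ring)
  rw [h3]
  linarith

/-- **The dynamical parity floor.** For `t ≥ 0`,
`escapeTransient_N(t) ≥ −(γ/(2T²)) ∫ (h₀ − h₀∘Θ)² dμ_T` — `escapeTransient_N(t) = (γ/T²)∫₀ᵗ ∫_{(s,∞)} K_N`
(`integral_transient_eq`), the integrated tail identity, and the contraction floor. [folklore] -/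
theorem escapeTransient_ge (hω : 0 < ω₂) (hl : 0 < lam) (hβ : 0 < β) (hγ : 0 < γ) (hN : 0 < N) (hT : 0 < T)
    {t : ℝ} (ht : 0 ≤ t) :
    -(γ / (2 * T ^ 2) * ∫ z, (kinCorrector ω₂ lam β γ T N ⟨0, hN⟩ z -
        kinCorrector ω₂ lam β γ T N ⟨0, hN⟩ (z.1, -z.2)) ^ 2 ∂((pinnedChain ω₂ lam β γ).gibbsMeasure N T)) ≤
      escapeTransient ω₂ lam β γ T N t := by
  set P := pinnedChain ω₂ lam β γ with hP
  have hϑ0 : (0 : ℝ) < 1 / (4 * T) := by positivity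
  have h2ϑ : 2 * (1 / (4 * T)) < 1 / T := by
    rw [show 2 * (1 / (4 * T)) = 1 / (2 * T) by ring, one_div_lt_one_div (by positivity) hT]; linarith
  have hϑ1 : 1 / (4 * T) < 1 / T := by linarith
  obtain ⟨K, c, hK, hc, hb⟩ := harrisBound_exists hω hl.le hβ hγ hN hT hϑ0 hϑ1
  have hKi := integrableOn_escapeKernel hω hl hβ hγ hT N
  have e1 : escapeTransient ω₂ lam β γ T N t =
      γ / T ^ 2 * ∫ s in (0 : ℝ)..t, ∫ u in Ioi 0, escapeKernel ω₂ lam β γ T N (u + s) := by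
    rw [← integral_transient_eq hω hl hβ hγ hT N ht, ← intervalIntegral.integral_const_mul]
    refine intervalIntegral.integral_congr fun s hs => ?_
    have hs0 : 0 ≤ s := by
      rw [uIcc_of_le ht] at hs
      exact hs.1
    rw [stepResponse, escapeDeficit_eq, setIntegral_Ioi_comp_add_right (escapeKernel ω₂ lam β γ T N) s,
      ← intervalIntegral.integral_interval_add_Ioi hKi (hKi.mono_set (Ioi_subset_Ioi hs0))]
    ring
  rw [e1, integral_tail_eq hω hl hβ hγ hN hT hϑ0 h2ϑ hK.le hb hc ht]
  have key := integral_reversal_mul_sub_act_ge hω hl.le hβ hγ hN hT hϑ0 h2ϑ hb hc t.toNNReal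
  have hg : 0 ≤ γ / T ^ 2 := by positivity
  calc -(γ / (2 * T ^ 2) * ∫ z, (kinCorrector ω₂ lam β γ T N ⟨0, hN⟩ z -
          kinCorrector ω₂ lam β γ T N ⟨0, hN⟩ (z.1, -z.2)) ^ 2 ∂(P.gibbsMeasure N T))
      = γ / T ^ 2 * (-(1 / 2 : ℝ) * ∫ z, (kinCorrector ω₂ lam β γ T N ⟨0, hN⟩ z -
          kinCorrector ω₂ lam β γ T N ⟨0, hN⟩ (z.1, -z.2)) ^ 2 ∂(P.gibbsMeasure N T)) := by ring
    _ ≤ _ := mul_le_mul_of_nonneg_left key hg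

end Pinned

end Summit.AtomisticToContinuum.FouriersLaw.Theorems.BoundedResponse.ParityFloor

end
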